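import Summits.Ventures.HSemireg.WedgePointPairPowersPerQRank
import Summits.Ventures.HSemireg.FormulaNSurfacePowerPerQClosed

/-!
# Venture HSemireg — per-`q` blocks of the `n`-fold box of `m`-dimensional point pairs, companion: THE DEGREE-2 ROW (the
# `Ext²`-degree of the dictionary) IN CLOSED FORM for every `m ≥ 1` and every `n`

HONEST FRAMING. Part of the Lean index of the computation cell `pub-hsemireg` (seat p10 gen 5, Sunday typer «UNIFORM-IN-n»).
Natural-number arithmetic of p10's enumerator `genCount` + the rank theorem of `WedgePointPairPowersPerQRank.lean` ONLY: no variety,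
no cohomology theory, no sheaf, no Ext group, no semiregularity map is constructed here; nothing here says that HC / HC_CM / HC_AV
holds; no Literature fact is declared or used.  Custodian versions: STRUCTURE.md v1.0-SIGNED 9b196a05977dd067 (§1.1 C13 «per-q law
`[t² u^q] Q_n²` = `(2n²−n, n²−n, 2n², n²−n, 2n²−n)`», C10), theory/FORMULA-N.md PART A §4.1″ (th-6: the u-refined point atom, GLOBAL
component `q = 0` / LOCAL component `q = m − i`) / PART B §G (th-7).  Dictionary quoted, not asserted (degree `2` ↔ `Ext²`, block `q` ↔
Dolbeault index `H^{q+2}(Ω^q)`, `θ ↦ θ ∧ F` ↔ `⌟ch(F)`).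

THIS FILE.  The per-`q` rank theorem gives `rank_q(⋀^k) = genCount m n k q = Σ_z C(n,z) Σ_{j ≤ z, mj ≤ q} [t^k u^{q−mj}] R_m^{n−z}`
for every `m ≥ 1`, `n`, `k`, `q`; the rows typed in closed form so far are degree `1` (`…PerQDegreeOne`), the two extreme blocks
(`…PerQExtreme`), and ALL degrees only on the edges `n = 2` (th-6's `Q_m²`, C13) and `m = 2` (surfaces, `spCount`).  Here: THE
DEGREE-2 ROW for every `m ≥ 1`, `n`, `q`.
§1 `[t^k u^q] R_m^p` in low degree: **no terms below `t^p`** (`rbPow_eq_zero_of_lt` — every canonical non-empty local source has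
degree `≥ 1`, so a degree-`k` class has at least `n − k` empty blocks), `[t^k] R_m¹ = atomR` (`rbPow_one`), and
**`[t² u^r] R_m² = Σ_{r₁+r₂=r} qAtom m 1 r₁ · qAtom m 1 r₂`** (`rbPow_two_two`: two degree-1 atoms).
§2 hence in degree `2` only `z = n − 1` (ONE block carrying a degree-2 source) and `z = n − 2` (TWO blocks carrying one letter each)
contribute: `genCount m n 2 q = n·Σ_{j<n, mj ≤ q} qAtom m 2 (q − mj) + C(n,2)·Σ_{j<n−1, mj ≤ q} (qAtom m 1 ⋆ qAtom m 1)(q − mj)`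
(`genCount_two_eq_add`, every `n`, also `n = 0, 1`).
§3 the shift sums in closed form (`shift_qAtom_two`, `shift_qAtom_one_conv`): a source of fixed `q`-part `r` on `z` empty blocks
reaches exactly the blocks `r + mj`, `j < z + 1`.
§4 **THE DEGREE-2 ROW, UNIFORM IN `n` AND `m`** (`genCount_two_closed`; as a RANK statement for every field and `a, c ≠ 0`,
`finrank_range_blockProj_wedge_pairBox_two_closed`; as th-7's class count `card_Fset_two_closed`):
  `rank_q(⋀²) = n·C(m,2)·([∃ j<n, q = mj] + [m ≥ 3]·[∃ j<n, q = m−2+mj])`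
  `            + C(n,2)·m²·([∃ j<n−1, q = mj] + 2·[m ≥ 2]·[∃ j<n−1, q = m−1+mj] + [m ≥ 2]·[∃ j<n−1, q = 2m−2+mj])`
— in th-6's words: one degree-2 atom (global component `C(m,2)` at `q`-part `0` = the `Y`-pairs for `m ≥ 3` / the top collapse
`{x,x′} = X` for `m = 2`; local component `C(m,2)` at `q`-part `m − 2` = the proper `X`-pairs, `m ≥ 3`) shifted over its `n − 1`
empty blocks, or two degree-1 atoms on two distinct blocks (global·global `q`-part `0`, global·local `m − 1` twice, local·local
`2m − 2`; the global letter is a `Y`-letter for `m ≥ 2` and the top collapse `{x} = X` for `m = 1`, the local letter an `X`-letter,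
`m ≥ 2`) shifted over their `n − 2` empty blocks.
§5 EDGES AND ROWS: `n = 2` IS STRUCTURE C13 — the closed form at two factors equals the signed if-chain `sigmaBlockRank m`
(`(2m²−m, m²−m, 2m², m²−m, 2m²−m)` at `q = (0, m−2, m−1, m, 2m−2)`) for every `m ≥ 3` (`genCount_two_two_factors_eq_sigmaBlockRank`,
through th-6's `blockCount`); `m = 2` is the surface row `spCount n 2 q` by `WedgePointPairPowersPerQRank.genCount_two_eq_spCount`,
whose closed form is `FormulaNSurfacePowerPerQClosed.spCount_two_closed` (`(15,24,27,24,15)`, `(28,48,52,48,52,48,28)`, …; that file is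
imported here for its indicator-sum lemma `sum_range_ite_unique`); `m = 1` (curves: `P_1 = 1 + t`) reads `C(n,2)·[q ≤ n − 2]`
(`genCount_two_closed_one`);
`n = 1` is THEOREM T's degree-2 atom `qAtom m 2` (`genCount_two_closed_single`); the pre-registered `m = n = 3` row
`(36,9,54,36,36,54,9,36,0,0)` and a NEW pre-registration `m = 4`, `n = 3` (fourfold factors, `24` generators):
`(66,0,18,96,66,0,66,96,18,0,66,0,0)` (sum `492 = [t²]P_4³ + 3·[t²]P_4² = 228 + 264`) by `decide` from the closed form (`genCount_two_rows`).
§6 THE SHAPE EXPANSION in every degree (`genCount_eq_sum_shapes`, all `m, n, k, q`): `genCount m n k q = Σ_{p ≤ k} C(n,p) ·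
Σ_{j < n+1−p, mj ≤ q} [t^k u^{q−mj}] R_m^p` — `p` = the number of NON-EMPTY blocks of the class, `≤ k`; the two steps of this file
(vanishing below `t^p` + shift sums) are what a successor repeats for the rows `k ≥ 3`.
WHAT IS NOT HERE: anything Ext-side (bridge `σ∘ev = ⌟ch` and Ext counts by value, as in every p10 file); the closed rows `k ≥ 3` for
general `(m, n)`; a residue-class (`q mod m`) rewriting of the five progressions (for `m ≥ 3` they sit on the residues `0, m−2, m−1`).
Namespaces `Summit.Ventures.HSemireg.FormulaN.Uniform` (§1–§3, §5, §6 arithmetic) and `Summit.Ventures.HSemireg.Wedge.PairPowers` (§4 rank /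
class count); new names only; a LEAF over `WedgePointPairPowersPerQRank.lean` (+ the arithmetic file `FormulaNSurfacePowerPerQClosed.lean`),
independent of the sibling leaves (Overlap / Symm / Extreme / ExtremeOnto / DegreeOne).
-/

open Finset

namespace Summit.Ventures.HSemireg.FormulaN.Uniform

/-! ## §1. `[t^k u^q] R_m^p` in low degree -/

/-- the degree-`0` part is removed from `R_m = Q_m − 1 − u^m`: `atomR m 0 q = 0`. -/
theorem atomR_zero (m q : ℕ) : atomR m 0 q = 0 := by
  rw [atomR, if_pos rfl]

/-- in positive degree the atom of `R_m` is th-6's u-refined point atom. -/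
theorem atomR_of_ne_zero (m : ℕ) {j : ℕ} (hj : j ≠ 0) (q : ℕ) : atomR m j q = qAtom m j q := by
  rw [atomR, if_neg hj]

/-- **`[t^k u^q] R_m^p = 0` for `k < p`**: every canonical non-empty local source has degree `≥ 1` (so a degree-`k` class of the
`n`-fold box has at least `n − k` empty blocks). -/
theorem rbPow_eq_zero_of_lt (m : ℕ) : ∀ p k q : ℕ, k < p → rbPow m p k q = 0
  | 0, _, _, h => absurd h (Nat.not_lt_zero _)
  | p + 1, k, q, h => by
    rw [rbPow]
    refine Finset.sum_eq_zero fun ab hab => Finset.sum_eq_zero fun pr _ => ?_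
    rw [Finset.HasAntidiagonal.mem_antidiagonal] at hab
    rcases Nat.eq_zero_or_pos ab.2 with hb | hb
    · rw [hb, atomR_zero, mul_zero]
    · rw [rbPow_eq_zero_of_lt m p ab.1 pr.1 (by omega), zero_mul]

/-- one factor: **`[t^k u^q] R_m = atomR m k q`** (`m ≥ 1`). -/
theorem rbPow_one {m : ℕ} (hm : 1 ≤ m) (k q : ℕ) : rbPow m 1 k q = atomR m k q := by
  have h := coeff_Rb_pow hm 1 k q
  rw [pow_one, coeff_Rb hm] at h
  exact_mod_cast h.symm

/-- two factors in degree 2: **`[t² u^r] R_m² = Σ_{r₁ + r₂ = r} qAtom m 1 r₁ · qAtom m 1 r₂`** — two degree-1 atoms (the degree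
splits `(0,2), (1,1), (2,0)` and the outer two vanish, `atomR m 0 = 0`). -/
theorem rbPow_two_two {m : ℕ} (hm : 1 ≤ m) (r : ℕ) :
    rbPow m 2 2 r = ∑ ps ∈ antidiagonal r, qAtom m 1 ps.1 * qAtom m 1 ps.2 := by
  rw [rbPow, Nat.sum_antidiagonal_eq_sum_range_succ
    (fun a b => ∑ pr ∈ antidiagonal r, rbPow m 1 a pr.1 * atomR m b pr.2) 2]
  simp only [Finset.sum_range_succ, Finset.sum_range_zero, zero_add, rbPow_one hm, atomR_zero, zero_mul, mul_zero,
    Finset.sum_const_zero, add_zero, Nat.sub_zero, Nat.sub_self, show 2 - 1 = 1 from rfl,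
    atomR_of_ne_zero m one_ne_zero]

/-! ## §2. Degree 2: only `z = n − 1` and `z = n − 2` empty blocks contribute -/

/-- an indicator of `z + a = n` summed over `z ≤ n` picks `z = n − a` (if `a ≤ n`). -/
theorem sum_range_succ_ite_add_eq (n a : ℕ) (f : ℕ → ℕ) :
    ∑ z ∈ range (n + 1), (if z + a = n then f z else 0) = if a ≤ n then f (n - a) else 0 := by
  split_ifs with h
  · rw [Finset.sum_eq_single_of_mem (n - a) (mem_range.mpr (by omega))]
    · rw [if_pos (by omega)]
    · intro z _ hz
      exact if_neg (by omega)
  · exact Finset.sum_eq_zero fun z _ => if_neg (by omega)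

/-- the `z`-th term of `genCount m n 2 q`: zero unless `n − z ∈ {1, 2}`; at `z = n − 1` the inner coefficient is the degree-2 atom
`qAtom m 2`, at `z = n − 2` the convolution of two degree-1 atoms (`m ≥ 1`). -/
theorem genCount_two_term {m : ℕ} (hm : 1 ≤ m) (n q z : ℕ) :
    n.choose z * ∑ j ∈ range (z + 1), (if m * j ≤ q then rbPow m (n - z) 2 (q - m * j) else 0) =
      (if z + 1 = n then n * ∑ j ∈ range (z + 1), (if m * j ≤ q then qAtom m 2 (q - m * j) else 0) else 0) +
      (if z + 2 = n then n.choose 2 * ∑ j ∈ range (z + 1),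
        (if m * j ≤ q then (∑ ps ∈ antidiagonal (q - m * j), qAtom m 1 ps.1 * qAtom m 1 ps.2) else 0) else 0) := by
  obtain h0 | h1 | h2 | h3 : n - z = 0 ∨ n = z + 1 ∨ n = z + 2 ∨ 3 ≤ n - z := by omega
  · rw [h0, if_neg (by omega), if_neg (by omega), add_zero]
    refine mul_eq_zero_of_right _ (Finset.sum_eq_zero fun j _ => ?_)
    simp [rbPow]
  · subst h1
    rw [if_pos rfl, if_neg (by omega), add_zero, Nat.add_sub_cancel_left, Nat.choose_succ_self_right]
    congr 1
    refine Finset.sum_congr rfl fun j _ => ?_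
    rw [rbPow_one hm, atomR_of_ne_zero m two_ne_zero]
  · subst h2
    rw [if_neg (by omega), if_pos rfl, zero_add, Nat.add_sub_cancel_left, Nat.choose_symm_add]
    congr 1
    refine Finset.sum_congr rfl fun j _ => ?_
    rw [rbPow_two_two hm]
  · rw [if_neg (by omega), if_neg (by omega), add_zero]
    refine mul_eq_zero_of_right _ (Finset.sum_eq_zero fun j _ => ?_)
    rw [rbPow_eq_zero_of_lt m (n - z) 2 _ (by omega), ite_self]

/-- **in degree 2 only ONE-block and TWO-block shapes occur**: for every `m ≥ 1`, `n`, `q`,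
`genCount m n 2 q = n · Σ_{j<n, mj ≤ q} qAtom m 2 (q − mj) + C(n,2) · Σ_{j<n−1, mj ≤ q} (qAtom m 1 ⋆ qAtom m 1)(q − mj)`
(one block with a degree-2 source and `n − 1` empty blocks, shifts `j ≤ n − 1`; two blocks with one letter each and `n − 2` empty
blocks, shifts `j ≤ n − 2`; `n = 0, 1` included). -/
theorem genCount_two_eq_add {m : ℕ} (hm : 1 ≤ m) (n q : ℕ) :
    genCount m n 2 q =
      n * ∑ j ∈ range n, (if m * j ≤ q then qAtom m 2 (q - m * j) else 0) +
      n.choose 2 * ∑ j ∈ range (n - 1),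
        (if m * j ≤ q then (∑ ps ∈ antidiagonal (q - m * j), qAtom m 1 ps.1 * qAtom m 1 ps.2) else 0) := by
  rw [genCount, Finset.sum_congr rfl (fun z _ => genCount_two_term hm n q z), Finset.sum_add_distrib,
    sum_range_succ_ite_add_eq n 1, sum_range_succ_ite_add_eq n 2]
  rcases n with _ | _ | n
  · simp
  · simp
  · rw [if_pos (by omega), if_pos (by omega), show n + 2 - 1 = n + 1 from rfl, show n + 2 - 2 = n from rfl]

/-! ## §3. The shift sums in closed form -/

/-- a sum of ONE indicator guarded by a constant condition `P`, with at most one solution, is a guarded indicator of solvability. -/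
theorem sum_range_ite_and_unique (P : Prop) [Decidable P] (p : ℕ → Prop) [DecidablePred p] (N c : ℕ)
    (huniq : ∀ a b, p a → p b → a = b) :
    ∑ j ∈ range N, (if P ∧ p j then c else 0) = if P ∧ ∃ j, j < N ∧ p j then c else 0 := by
  by_cases hP : P
  · simp only [hP, true_and]
    exact sum_range_ite_unique p N c huniq
  · simp only [hP, false_and, if_false, Finset.sum_const_zero]

/-- **one degree-2 atom shifted over the empty blocks**: `Σ_{j<J, mj ≤ q} qAtom m 2 (q − mj) =
C(m,2)·[∃ j<J, q = mj] + C(m,2)·[m ≥ 3]·[∃ j<J, q = m − 2 + mj]` (global component: `q`-part `0`; local component: `q`-part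
`m − 2`, present for `2 < m`; `m ≥ 1`). -/
theorem shift_qAtom_two {m : ℕ} (hm : 1 ≤ m) (J q : ℕ) :
    ∑ j ∈ range J, (if m * j ≤ q then qAtom m 2 (q - m * j) else 0) =
      (if ∃ j, j < J ∧ q = m * j then m.choose 2 else 0) +
      (if 2 < m ∧ ∃ j, j < J ∧ q = m - 2 + m * j then m.choose 2 else 0) := by
  have h1 : ∀ j, (if m * j ≤ q then qAtom m 2 (q - m * j) else 0) =
      (if q = m * j then m.choose 2 else 0) + (if 2 < m ∧ q = m - 2 + m * j then m.choose 2 else 0) := by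
    intro j
    rw [qAtom]
    generalize m * j = x
    generalize m.choose 2 = c
    split_ifs <;> omega
  simp_rw [h1]
  rw [Finset.sum_add_distrib, sum_range_ite_unique (fun j => q = m * j) J (m.choose 2)
    (fun a b ha hb => Nat.eq_of_mul_eq_mul_left hm (ha.symm.trans hb)),
    sum_range_ite_and_unique (2 < m) (fun j => q = m - 2 + m * j) J (m.choose 2)
      (fun a b ha hb => Nat.eq_of_mul_eq_mul_left hm (Nat.add_left_cancel (ha.symm.trans hb)))]

/-- **two degree-1 atoms shifted over the empty blocks**: `Σ_{j<J, mj ≤ q} (qAtom m 1 ⋆ qAtom m 1)(q − mj) =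
m²·[∃ j<J, q = mj] + 2m²·[m ≥ 2]·[∃ j<J, q = m − 1 + mj] + m²·[m ≥ 2]·[∃ j<J, q = 2m − 2 + mj]` (global·global, global·local twice,
local·local; `m ≥ 1`). -/
theorem shift_qAtom_one_conv {m : ℕ} (hm : 1 ≤ m) (J q : ℕ) :
    ∑ j ∈ range J, (if m * j ≤ q then (∑ ps ∈ antidiagonal (q - m * j), qAtom m 1 ps.1 * qAtom m 1 ps.2) else 0) =
      (if ∃ j, j < J ∧ q = m * j then m * m else 0) +
      (if 1 < m ∧ ∃ j, j < J ∧ q = m - 1 + m * j then 2 * (m * m) else 0) +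
      (if 1 < m ∧ ∃ j, j < J ∧ q = 2 * m - 2 + m * j then m * m else 0) := by
  have h1 : ∀ j, (if m * j ≤ q then (∑ ps ∈ antidiagonal (q - m * j), qAtom m 1 ps.1 * qAtom m 1 ps.2) else 0) =
      (if q = m * j then m * m else 0) + (if 1 < m ∧ q = m - 1 + m * j then 2 * (m * m) else 0) +
        (if 1 < m ∧ q = 2 * m - 2 + m * j then m * m else 0) := by
    intro j
    by_cases hle : m * j ≤ q
    · rw [if_pos hle, sum_antidiagonal_qAtom, Nat.choose_one_right]
      generalize m * j = x at hle ⊢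
      generalize m * m = M
      split_ifs <;> omega
    · rw [if_neg hle]
      generalize m * j = x at hle ⊢
      split_ifs <;> omega
  simp_rw [h1]
  rw [Finset.sum_add_distrib, Finset.sum_add_distrib, sum_range_ite_unique (fun j => q = m * j) J (m * m)
    (fun a b ha hb => Nat.eq_of_mul_eq_mul_left hm (ha.symm.trans hb)),
    sum_range_ite_and_unique (1 < m) (fun j => q = m - 1 + m * j) J (2 * (m * m))
      (fun a b ha hb => Nat.eq_of_mul_eq_mul_left hm (Nat.add_left_cancel (ha.symm.trans hb))),
    sum_range_ite_and_unique (1 < m) (fun j => q = 2 * m - 2 + m * j) J (m * m)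
      (fun a b ha hb => Nat.eq_of_mul_eq_mul_left hm (Nat.add_left_cancel (ha.symm.trans hb)))]

/-! ## §4. THE DEGREE-2 ROW in closed form, every `m ≥ 1`, `n` -/

/-- **THE DEGREE-2 ROW OF p10's ENUMERATOR IN CLOSED FORM**, every `m ≥ 1`, `n`, `q`:
`genCount m n 2 q = n·(C(m,2)·[∃ j<n, q = mj] + C(m,2)·[2<m]·[∃ j<n, q = m−2+mj])`
`  + C(n,2)·(m²·[∃ j<n−1, q = mj] + 2m²·[1<m]·[∃ j<n−1, q = m−1+mj] + m²·[1<m]·[∃ j<n−1, q = 2m−2+mj])`. -/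
theorem genCount_two_closed {m : ℕ} (hm : 1 ≤ m) (n q : ℕ) :
    genCount m n 2 q =
      n * ((if ∃ j, j < n ∧ q = m * j then m.choose 2 else 0) +
          (if 2 < m ∧ ∃ j, j < n ∧ q = m - 2 + m * j then m.choose 2 else 0)) +
      n.choose 2 * ((if ∃ j, j < n - 1 ∧ q = m * j then m * m else 0) +
          (if 1 < m ∧ ∃ j, j < n - 1 ∧ q = m - 1 + m * j then 2 * (m * m) else 0) +
          (if 1 < m ∧ ∃ j, j < n - 1 ∧ q = 2 * m - 2 + m * j then m * m else 0)) := by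
  rw [genCount_two_eq_add hm, shift_qAtom_two hm, shift_qAtom_one_conv hm]

/-! ## §5. Edges and rows -/

/-- **EDGE `n = 2` IS STRUCTURE C13**: at two factors the degree-2 row is the signed if-chain `sigmaBlockRank m`
(`(2m²−m, m²−m, 2m², m²−m, 2m²−m)` at `q = (0, m−2, m−1, m, 2m−2)`, `0` elsewhere) for every `m ≥ 3` — through th-6's per-q law
`genCount m 2 k q = blockCount m k q` (`k ≥ 1`, `WedgePointPairPowersPerQRank`) and `blockCount_two_eq_sigmaBlockRank`
(`FormulaNUniformBlocks`); so §4 read at `n = 2` (shifts `j < 2` for the one-block shapes, `j < 1` for the two-block shapes: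
`q = 0`: `2C(m,2) + m²`; `q = m−2`, `q = m`: `2C(m,2)`; `q = m−1`: `2m²`; `q = 2m−2`: `2C(m,2) + m²`) is C13's closed form. -/
theorem genCount_two_two_factors_eq_sigmaBlockRank {m : ℕ} (hm : 3 ≤ m) (q : ℕ) : genCount m 2 2 q = sigmaBlockRank m q := by
  rw [Wedge.PairPowers.genCount_two_factors_eq_blockCount (show 1 ≤ m by omega) (show 1 ≤ 2 by norm_num),
    blockCount_two_eq_sigmaBlockRank hm]

/-- **EDGE `n = 1`** (one factor, no shift): the degree-2 row is THEOREM T's degree-2 atom `qAtom m 2 q =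
C(m,2)·([q = 0] + [2 < m ∧ q = m − 2])`. -/
theorem genCount_two_closed_single {m : ℕ} (hm : 1 ≤ m) (q : ℕ) : genCount m 1 2 q = qAtom m 2 q := by
  rw [genCount_two_eq_add hm]
  simp

/-- **EDGE `m = 1`** (curve factors, `P_1 = 1 + t`: one `X`-letter and one `Y`-letter per block, the only canonical sources `∅` and
the top collapse `{x}`, `q`-part `0`): `genCount 1 n 2 q = C(n,2)·[q + 2 ≤ n]` — two one-letter blocks, `n − 2` empty blocks, all
shifts `q = j ≤ n − 2` of block size `m = 1`. -/
theorem genCount_two_closed_one (n q : ℕ) : genCount 1 n 2 q = if q + 2 ≤ n then n.choose 2 else 0 := by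
  rw [genCount_two_closed le_rfl]
  have e : (∃ j, j < n - 1 ∧ q = 1 * j) ↔ q + 2 ≤ n := ⟨fun ⟨j, hj, hq⟩ => by omega, fun h => ⟨q, by omega, (one_mul q).symm⟩⟩
  simp only [Nat.choose_eq_zero_of_lt (show 1 < 2 by norm_num), lt_irrefl, false_and, if_false, ite_self, add_zero, mul_zero,
    zero_add, mul_one, if_congr e rfl rfl, mul_ite]

/-- **ROWS** from the closed form, by `decide`: the pre-registered `m = n = 3` degree-2 row `(36,9,54,36,36,54,9,36,0,0)`
(`FormulaNPerQUniform.genCount_predictions_three`, there by kernel evaluation of the enumerator); a NEW pre-registration, fourfold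
factors `m = 4`, `n = 3` (`24` generators, blocks `q = 0..12`): `(66,0,18,96,66,0,66,96,18,0,66,0,0)`, sum `492 = 228 + 3·88 =
[t²]P_4³ + 3·[t²]P_4²` (the overlap identity of `WedgePointPairPowersPerQOverlap`); and the measured surface row `m = 2`, `n = 4`:
`(28,48,52,48,52,48,28)`. -/
theorem genCount_two_rows :
    (List.range 10).map (fun q => genCount 3 3 2 q) = [36, 9, 54, 36, 36, 54, 9, 36, 0, 0] ∧
    (List.range 13).map (fun q => genCount 4 3 2 q) = [66, 0, 18, 96, 66, 0, 66, 96, 18, 0, 66, 0, 0] ∧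
    (List.range 7).map (fun q => genCount 2 4 2 q) = [28, 48, 52, 48, 52, 48, 28] := by
  simp only [genCount_two_closed (show 1 ≤ 3 by norm_num), genCount_two_closed (show 1 ≤ 4 by norm_num),
    genCount_two_closed (show 1 ≤ 2 by norm_num)]
  decide

/-! ## §6. The shape expansion in every degree (the same two steps for the rows `k ≥ 3`) -/

/-- **THE SHAPE EXPANSION**, every `m`, `n`, `k`, `q`:
`genCount m n k q = Σ_{p ≤ k} C(n,p) · Σ_{j < n+1−p, mj ≤ q} [t^k u^{q−mj}] R_m^p` — a degree-`k` class has `p ≤ k` NON-EMPTY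
blocks (`rbPow_eq_zero_of_lt`), chosen in `C(n,p)` ways (the terms `p > n` vanish by `C(n,p) = 0`), and is shifted by `jm`, `j ≤ n − p`,
over its `n − p` empty blocks (window written `range (n + 1 − p)` so that no successor-of-a-difference appears).  Degree 2 = §2 (`p = 1, 2`); for degree 3 the successor needs `[t³] R_m^p`, `p = 1, 2, 3`: the atom `qAtom m 3`,
`2·(qAtom m 1 ⋆ qAtom m 2)` and `(qAtom m 1)^{⋆3}`. -/
theorem genCount_eq_sum_shapes (m n k q : ℕ) :
    genCount m n k q = ∑ p ∈ range (k + 1), n.choose p *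
      ∑ j ∈ range (n + 1 - p), (if m * j ≤ q then rbPow m p k (q - m * j) else 0) := by
  set F : ℕ → ℕ := fun p => n.choose p * ∑ j ∈ range (n + 1 - p), (if m * j ≤ q then rbPow m p k (q - m * j) else 0) with hF
  have h1 : genCount m n k q = ∑ p ∈ range (n + 1), F p := by
    rw [genCount, ← Finset.sum_range_reflect]
    refine Finset.sum_congr rfl fun p hp => ?_
    rw [mem_range] at hp
    rw [hF]
    simp only
    rw [show n + 1 - 1 - p = n - p by omega, Nat.choose_symm (by omega : p ≤ n), Nat.sub_sub_self (by omega : p ≤ n),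
      show n - p + 1 = n + 1 - p by omega]
  have hsub1 : range (n + 1) ⊆ range (n + k + 1) := Finset.range_subset_range.2 (by omega)
  have hsub2 : range (k + 1) ⊆ range (n + k + 1) := Finset.range_subset_range.2 (by omega)
  have hN : ∑ p ∈ range (n + 1), F p = ∑ p ∈ range (n + k + 1), F p :=
    Finset.sum_subset hsub1 fun p _ hpn => by
      rw [mem_range, not_lt] at hpn
      rw [hF]
      simp only
      rw [Nat.choose_eq_zero_of_lt (by omega), zero_mul]
  have hK : ∑ p ∈ range (k + 1), F p = ∑ p ∈ range (n + k + 1), F p :=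
    Finset.sum_subset hsub2 fun p _ hpk => by
      rw [mem_range, not_lt] at hpk
      rw [hF]
      simp only
      refine mul_eq_zero_of_right _ (Finset.sum_eq_zero fun j _ => ?_)
      rw [rbPow_eq_zero_of_lt m p k _ (by omega), ite_self]
  change genCount m n k q = ∑ p ∈ range (k + 1), F p
  rw [h1, hN, hK]

end Summit.Ventures.HSemireg.FormulaN.Uniform

/-! ## §4 (bis). The degree-2 row as th-7's class count and as a RANK statement -/

open Module

namespace Summit.Ventures.HSemireg.Wedge.PairPowers

open Summit.Ventures.HSemireg.Wedge Summit.Ventures.HSemireg.Wedge.Kunneth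

variable (K : Type*) [Field K] {m : ℕ} {n : ℕ}

/-- **th-7's degree-2 classes reaching block `q`, counted in closed form** (every `m ≥ 1`, `n`, `q`): option data of degree `2` is
ONE block with a two-letter canonical source (a `Y`-pair, `m ≥ 3`, or the top collapse `X` at `m = 2`: `q`-part `0`; a proper
`X`-pair, `m ≥ 3`: `q`-part `m − 2`) and `n − 1` empty blocks, or TWO blocks with one letter each (`Y`/top-collapse letter:
`q`-part `0`; `X`-letter, `m ≥ 2`: `q`-part `m − 1`) and `n − 2` empty blocks; the class reaches `q_f + mj`, `j ≤ z`. -/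
theorem card_Fset_two_closed (hm : 1 ≤ m) (q : ℕ) :
    (Fset m n 2 q).card =
      n * ((if ∃ j, j < n ∧ q = m * j then m.choose 2 else 0) +
          (if 2 < m ∧ ∃ j, j < n ∧ q = m - 2 + m * j then m.choose 2 else 0)) +
      n.choose 2 * ((if ∃ j, j < n - 1 ∧ q = m * j then m * m else 0) +
          (if 1 < m ∧ ∃ j, j < n - 1 ∧ q = m - 1 + m * j then 2 * (m * m) else 0) +
          (if 1 < m ∧ ∃ j, j < n - 1 ∧ q = 2 * m - 2 + m * j then m * m else 0)) := by
  rw [card_Fset hm, FormulaN.Uniform.genCount_two_closed hm]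

/-- **THE DEGREE-2 PER-`q` ROW, UNIFORM IN `n` AND `m`.**  For every field `K`, every `m ≥ 1`, every `n`, every block `q` and
`a, c ≠ 0`, the rank of the `q`-block of `θ ↦ θ ∧ F` on `⋀² K^{(m+m)n}` (`F` the `n`-fold box of `m`-dimensional point pairs; in the
dictionary: `σ` restricted to the `Ext²`-degree, read in the Dolbeault block `H^{q+2}(Ω^q)`) is
`n·C(m,2)·([∃ j<n, q = mj] + [2<m]·[∃ j<n, q = m−2+mj])`
`  + C(n,2)·m²·([∃ j<n−1, q = mj] + 2·[1<m]·[∃ j<n−1, q = m−1+mj] + [1<m]·[∃ j<n−1, q = 2m−2+mj])`;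
`n = 2`: C13's `(2m²−m, m²−m, 2m², m²−m, 2m²−m)`; `m = 2`: the surface rows `(15,24,27,24,15)`, `(28,48,52,48,52,48,28)`, …;
`m = n = 3`: `(36,9,54,36,36,54,9,36,0,0)`; `m = 4`, `n = 3`: `(66,0,18,96,66,0,66,96,18,0,66,0,0)`. -/
theorem finrank_range_blockProj_wedge_pairBox_two_closed (hm : 1 ≤ m) {a c : K} (ha : a ≠ 0) (hc : c ≠ 0) (q : ℕ) :
    finrank K (LinearMap.range (blockProj K m n q ∘ₗ wedge K (Fin ((m + m) * n)) 2 (pairBox K (m := m) (n := n) a c))) =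
      n * ((if ∃ j, j < n ∧ q = m * j then m.choose 2 else 0) +
          (if 2 < m ∧ ∃ j, j < n ∧ q = m - 2 + m * j then m.choose 2 else 0)) +
      n.choose 2 * ((if ∃ j, j < n - 1 ∧ q = m * j then m * m else 0) +
          (if 1 < m ∧ ∃ j, j < n - 1 ∧ q = m - 1 + m * j then 2 * (m * m) else 0) +
          (if 1 < m ∧ ∃ j, j < n - 1 ∧ q = 2 * m - 2 + m * j then m * m else 0)) := by
  rw [finrank_range_blockProj_wedge_pairBox K hm ha hc, FormulaN.Uniform.genCount_two_closed hm]

/-- the fourfold-factor pre-registration as a RANK statement: `m = 4`, `n = 3` (`24` generators), degree 2, blocks `q = 0, …, 12`: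
`(66,0,18,96,66,0,66,96,18,0,66,0,0)`. -/
theorem perq_row_two_fourfold_triple {a c : K} (ha : a ≠ 0) (hc : c ≠ 0) :
    (List.range 13).map (fun q => finrank K (LinearMap.range
        (blockProj K 4 3 q ∘ₗ wedge K (Fin ((4 + 4) * 3)) 2 (pairBox K (m := 4) (n := 3) a c)))) =
      [66, 0, 18, 96, 66, 0, 66, 96, 18, 0, 66, 0, 0] := by
  simp only [finrank_range_blockProj_wedge_pairBox K (show 1 ≤ 4 by norm_num) ha hc]
  exact FormulaN.Uniform.genCount_two_rows.2.1

end Summit.Ventures.HSemireg.Wedge.PairPowers
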